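import Summits.BirchSwinnertonDyer.BirchSwinnertonDyer.Theorems.GenusKolyvaginAtTwoPowDvdShaCardAtTwoRTRungDescentVariants
import Literature.NumberTheory.EllipticCurves.RootNumber
import HarnessLib

/-!
# Route `GenusKolyvaginAtTwo`, LINE 18 (L_T `PowDvdShaCardAtTwoRT`, stmt-BirchSwinnertonDyer-23242), stub L
# `stub_twinShaLaddersAtTwo` — ITS CONCLUSION FROM DEPTH-INDEXED K-SIDE SUPPLIES, FOR EITHER ROOT NUMBER (the interleaving of
# Kolyvagin's minima done in the kernel)

Seat `bsd-line-gk2-p2` g18 (PROVER seat 2/3, cell `bsd-f1-sign2`), `--supports stmt-BirchSwinnertonDyer-23242` (helper; closes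
nothing). THEOREMS ONLY (no definition, no named fact, no `sorry`); BSD is not proved by any of this.

WHY. `twinShaLadders_of_Kside_supplies` (`w(E) = +1`) and `…_swapped` (`w(E) = −1`) take RUNG-indexed supplies and a ladder already
shaped like stub L's. Kolyvagin's objects are DEPTH-indexed: minima `M_r` (`r` = number of primes), classes at depth `r` of sign
`ε_r = −w(E)(−1)^r`; the Mordell–Weil class `δ(y_K)` has sign `−w(E)` = the sign of EVEN depths, and the rank-`0` member of the ℚ-pair is
the one of sign `+w(E)` = ODD depths. So, for every root number: odd depth `2m+1` ↔ McCallum budget `r`, NO seed, family size `r+1 = 2m+2`;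
even depth `2m+2` ↔ seed `⟨δ(y_K)⟩`, family size `r = 2m+2`; only the RECEIVING ℚ-curve depends on `w(E)` (odd depths go to `W` if
`w(E) = +1`, to `Wd` if `w(E) = −1`), and with it the ladder: `M := M_•` if `w(E) = +1`, the interleaved
`M(2m) := M_{2m}`, `M(2m+1) := M_{2m} − (M_{2m+1} − M_{2m+2})` if `w(E) = −1`. This file performs that case split once and for all:

* `exists_shaFamily_zero` — rungs with no drop need no supply (the zero family has order `2^0`).
* **`twinShaLadders_of_depth_supplies`** — stub L's conclusion VERBATIM from: the frame at level `2^L` (`E(K)[2^L] = 0`, `g`, `P₀ = y_K`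
  with `2^L ∤ P₀`, `Wd` an elliptic ℚ-model of `W^{(d_K)}`), the rank-`0` side's `2^L`-divisibility keyed to the root number
  (`w(E) = 1 ∧ W(ℚ) = 2^L W(ℚ)` or `w(E) = −1 ∧ Wd(ℚ) = 2^L Wd(ℚ)`), DEPTH-indexed minima `Mr` (antitone, `Mr 0 = M₀`, `Mr R = 0`), and
  McCallum-shaped supplies at the depths with a positive drop: odd depths with sign `w(E)` and no seed, even depths with sign `−w(E)` and
  the seed `⟨δ(P₀)⟩` (fed by `…RTRungSupplyShape` / `…Separation` / `…Intrinsic` with `ε := ±W.rootNumber`).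

References: [McCallumLMS1991] §5 p. 285 (`ε_r = (−1)^r ε`), Prop. 5.2, Thm. 5.4; [GrossLMS1991] §5 (5.2), Prop. 5.3–5.4; [Kolyvagin1991MathAnn] Thm. 1.
-/

set_option autoImplicit false
-- the Theorems namespace of this sub repeats the summit name by design (D-0017 nested layout)
set_option linter.dupNamespace false

noncomputable section

open scoped Classical

namespace Summit.BirchSwinnertonDyer.BirchSwinnertonDyer.Theorems.GenusExact.PlusDescent

open WeierstrassCurve NumberField Field Literature.NumberTheory.EllipticCurves
  Literature.NumberTheory.GaloisRepresentations AddSubgroup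

/-- **A rung with no drop needs no supply**: the zero family has order `2^0` and is independent modulo `2^0`. [folklore] -/
theorem exists_shaFamily_zero (X : WeierstrassCurve ℚ) (K : Type) [Field K] [NumberField K] (s : ℕ) :
    ∃ x : Fin s → X.galH1, (∀ i, resBaseChange X K (x i) ∈ (X.baseChange K).sha) ∧
      (∀ i, addOrderOf (x i) = 2 ^ 0) ∧
      ∀ e : Fin s → ℤ, ∑ i, e i • x i = 0 → ∀ i, ((2 ^ 0 : ℕ) : ℤ) ∣ e i :=
  ⟨fun _ ↦ 0, fun _ ↦ by rw [map_zero]; exact AddSubgroup.zero_mem _, fun _ ↦ by rw [pow_zero, addOrderOf_zero],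
    fun e _ i ↦ by rw [pow_zero, Nat.cast_one]; exact one_dvd _⟩

variable (W : WeierstrassCurve ℚ) [W.IsElliptic] (K : Type) [Field K] [NumberField K]
  (h2 : Module.finrank ℚ K = 2) (σ : K ≃ₐ[ℚ] K) (hσ : σ ≠ 1) (L : ℕ)

include h2 hσ in
/-- **STUB L's CONCLUSION FROM DEPTH-INDEXED SUPPLIES, EITHER ROOT NUMBER.** Frame at level `2^L` over the quadratic `K` (`σ ≠ 1`):
`E(K)[2^L] = 0`, `E(K̄)` `2^L`-divisible, `g` generating `E(K)` modulo `2^L`, `P₀ ∈ E(K)` with `2^L ∤ P₀` (`P₀ = y_K`), `Wd` an elliptic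
ℚ-model of `W^{(d_K)}`; the RANK-`0` SIDE keyed to the root number: `w(E) = 1` and `W(ℚ)` `2^L`-divisible, or `w(E) = −1` and `Wd(ℚ)`
`2^L`-divisible. Depth minima `Mr` (antitone, `Mr 0 = M₀`, `Mr R = 0`). Supplies: at every ODD depth `2m+1` with `Mr(2m) > Mr(2m+1)`,
McCallum-shaped avoidance among Selmer classes of sign `w(E)` of order `2^{Mr(2m)−Mr(2m+1)}` with budget `2m+1` and no seed; at every EVEN
depth `2m+2` with `Mr(2m+1) > Mr(2m+2)`, the same for sign `−w(E)` with the seed `⟨δ(P₀)⟩`. THEN the conclusion of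
`stub_twinShaLaddersAtTwo` holds verbatim for `(W, K, M₀, Wd)`. [cite: McCallumLMS1991, §5 p. 285, Prop. 5.2, Thm. 5.4 (p. 310)]
[cite: GrossLMS1991, §5 Prop. 5.4] -/
theorem twinShaLadders_of_depth_supplies
    (hdiv : ∀ P : geomPoints (W.baseChange K), ∃ Q : geomPoints (W.baseChange K), ((2 ^ L : ℕ) : ℤ) • Q = P)
    (hL : ∀ P : (W.baseChange K).toAffine.Point, ((2 ^ L : ℕ) : ℤ) • P = 0 → P = 0)
    {Wd : WeierstrassCurve ℚ} [Wd.IsElliptic] (hWd : ∃ C : VariableChange ℚ, C • W.quadraticTwist (NumberField.discr K : ℚ) = Wd)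
    (hrank0 : (W.rootNumber = 1 ∧ ∀ P : W.toAffine.Point, ∃ Q : W.toAffine.Point, ((2 ^ L : ℕ) : ℤ) • Q = P) ∨
      (W.rootNumber = -1 ∧ ∀ P : Wd.toAffine.Point, ∃ Q : Wd.toAffine.Point, ((2 ^ L : ℕ) : ℤ) • Q = P))
    (g : (W.baseChange K).toAffine.Point)
    (hg : ∀ P : (W.baseChange K).toAffine.Point, ∃ (k : ℤ) (Q : (W.baseChange K).toAffine.Point),
      ((2 ^ L : ℕ) : ℤ) • Q = P - k • g)
    (P₀ : (W.baseChange K).toAffine.Point) (hP₀ : ∀ Q : (W.baseChange K).toAffine.Point, ((2 ^ L : ℕ) : ℤ) • Q ≠ P₀)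
    (M₀ R : ℕ) (Mr : ℕ → ℕ) (hMr : ∀ j, Mr (j + 1) ≤ Mr j) (hMr0 : Mr 0 = M₀) (hMrR : Mr R = 0)
    (hsupOdd : ∀ m : ℕ, Mr (2 * m + 1) < Mr (2 * m) →
      ∀ i < 2 * m + 2, ∀ u : Fin i → galH1Torsion (W.baseChange K) ((2 ^ L : ℕ) : ℤ),
      (∀ k, u k ∈ selmerGroup (W.baseChange K) ((2 ^ L : ℕ) : ℤ) ∧ conjAct W σ ((2 ^ L : ℕ) : ℤ) (u k) = W.rootNumber • u k) →
      (∀ k, addOrderOf (u k) = 2 ^ (Mr (2 * m) - Mr (2 * m + 1))) →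
      ∃ y : galH1Torsion (W.baseChange K) ((2 ^ L : ℕ) : ℤ),
        (y ∈ selmerGroup (W.baseChange K) ((2 ^ L : ℕ) : ℤ) ∧ conjAct W σ ((2 ^ L : ℕ) : ℤ) y = W.rootNumber • y) ∧
        addOrderOf y = 2 ^ (Mr (2 * m) - Mr (2 * m + 1)) ∧ Disjoint (zmultiples y) (AddSubgroup.closure (Set.range u)))
    (hsupEven : ∀ m : ℕ, Mr (2 * m + 2) < Mr (2 * m + 1) →
      ∀ i < 2 * m + 2, ∀ u : Fin i → galH1Torsion (W.baseChange K) ((2 ^ L : ℕ) : ℤ),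
      (∀ k, u k ∈ selmerGroup (W.baseChange K) ((2 ^ L : ℕ) : ℤ) ∧ conjAct W σ ((2 ^ L : ℕ) : ℤ) (u k) = (-W.rootNumber) • u k) →
      (∀ k, addOrderOf (u k) = 2 ^ (Mr (2 * m + 1) - Mr (2 * m + 2))) →
      ∃ y : galH1Torsion (W.baseChange K) ((2 ^ L : ℕ) : ℤ),
        (y ∈ selmerGroup (W.baseChange K) ((2 ^ L : ℕ) : ℤ) ∧ conjAct W σ ((2 ^ L : ℕ) : ℤ) y = (-W.rootNumber) • y) ∧
        addOrderOf y = 2 ^ (Mr (2 * m + 1) - Mr (2 * m + 2)) ∧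
        Disjoint (zmultiples y) (AddSubgroup.closure (Set.range u) ⊔
          zmultiples (kummerMapTorsion (W.baseChange K) ((2 ^ L : ℕ) : ℤ) hdiv P₀))) :
    ∃ (T : ℕ) (M : ℕ → ℕ), (∀ j, M (j + 1) ≤ M j) ∧ M 0 = M₀ ∧ M (2 * T) = 0 ∧
      (∀ m < T, ∃ x : Fin (2 * m + 2) → W.galH1, (∀ i, resBaseChange W K (x i) ∈ (W.baseChange K).sha) ∧
        (∀ i, addOrderOf (x i) = 2 ^ (M (2 * m) - M (2 * m + 1))) ∧
        ∀ c : Fin (2 * m + 2) → ℤ, ∑ i, c i • x i = 0 → ∀ i, ((2 ^ (M (2 * m) - M (2 * m + 1)) : ℕ) : ℤ) ∣ c i) ∧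
      (∀ m < T, ∃ x : Fin (2 * m + 2) → Wd.galH1, (∀ i, resBaseChange Wd K (x i) ∈ (Wd.baseChange K).sha) ∧
        (∀ i, addOrderOf (x i) = 2 ^ (M (2 * m + 1) - M (2 * m + 2))) ∧
        ∀ c : Fin (2 * m + 2) → ℤ, ∑ i, c i • x i = 0 → ∀ i, ((2 ^ (M (2 * m + 1) - M (2 * m + 2)) : ℕ) : ℤ) ∣ c i) := by
  have hn : ((2 ^ L : ℕ) : ℤ) ≠ 0 := by positivity
  -- antitonicity in the large
  have hanti : ∀ a b, a ≤ b → Mr b ≤ Mr a := fun a b hab ↦ by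
    induction hab with
    | refl => exact le_rfl
    | step _ ih => exact (hMr _).trans ih
  have hMr2R : Mr (2 * R) = 0 := Nat.eq_zero_of_le_zero (hMrR ▸ hanti R (2 * R) (by omega))
  rcases hrank0 with ⟨hw, hdivQ⟩ | ⟨hw, hdivWd⟩
  · /- `w(E) = +1`: odd depths (sign `+1`, no seed) go to `W` (rank 0), even depths (sign `−1`, seed) to `Wd`; ladder `M := Mr`. -/
    refine ⟨R, Mr, hMr, hMr0, hMr2R, fun m _ ↦ ?_, fun m _ ↦ ?_⟩
    · rcases Nat.eq_zero_or_pos (Mr (2 * m) - Mr (2 * m + 1)) with h0 | hpos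
      · rw [h0]; exact exists_shaFamily_zero W K _
      · refine exists_shaFamily_W_of_forall_exists_avoiding W K h2 σ hσ _ hn hdivQ hL (s := 2 * m + 2)
          (a := Mr (2 * m) - Mr (2 * m + 1)) fun i hi u hu hord ↦ ?_
        obtain ⟨y, ⟨hysel, hyτ⟩, hyord, hyav⟩ := hsupOdd m (by omega) i hi u
          (fun k ↦ ⟨(hu k).1, by rw [(hu k).2, hw, one_smul]⟩) hord
        exact ⟨y, ⟨hysel, by rw [hyτ, hw, one_smul]⟩, hyord, hyav⟩
    · rcases Nat.eq_zero_or_pos (Mr (2 * m + 1) - Mr (2 * m + 2)) with h0 | hpos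
      · rw [h0]; exact exists_shaFamily_zero Wd K _
      · refine exists_shaFamily_twin_of_forall_exists_avoiding W K h2 σ hσ L hdiv hL hWd g hg P₀ hP₀ (s := 2 * m + 2)
          (a := Mr (2 * m + 1) - Mr (2 * m + 2)) fun i hi u hu hord ↦ ?_
        obtain ⟨y, ⟨hysel, hyτ⟩, hyord, hyav⟩ := hsupEven m (by omega) i hi u
          (fun k ↦ ⟨(hu k).1, by rw [(hu k).2, hw, neg_one_zsmul]⟩) hord
        exact ⟨y, ⟨hysel, by rw [hyτ, hw, neg_one_zsmul]⟩, hyord, hyav⟩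
  · /- `w(E) = −1`: odd depths (sign `−1`, no seed) go to `Wd` (rank 0), even depths (sign `+1`, seed) to `W`; interleaved ladder. -/
    let M : ℕ → ℕ := fun j ↦ if j % 2 = 0 then Mr j else Mr (j - 1) - (Mr j - Mr (j + 1))
    have hMeven : ∀ m, M (2 * m) = Mr (2 * m) := fun m ↦ by
      simp only [M, Nat.mul_mod_right, if_true]
    have hModd : ∀ m, M (2 * m + 1) = Mr (2 * m) - (Mr (2 * m + 1) - Mr (2 * m + 2)) := fun m ↦ by
      have h1 : (2 * m + 1) % 2 = 1 := by omega
      simp only [M, h1, Nat.one_ne_zero, ↓reduceIte, Nat.add_sub_cancel]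
    have hdropW : ∀ m, M (2 * m) - M (2 * m + 1) = Mr (2 * m + 1) - Mr (2 * m + 2) := fun m ↦ by
      rw [hMeven, hModd]
      have := hMr (2 * m); have := hMr (2 * m + 1)
      omega
    have hdropWd : ∀ m, M (2 * m + 1) - M (2 * m + 2) = Mr (2 * m) - Mr (2 * m + 1) := fun m ↦ by
      rw [hModd, show 2 * m + 2 = 2 * (m + 1) by ring, hMeven]
      have := hMr (2 * m); have := hMr (2 * m + 1)
      rw [show 2 * (m + 1) = 2 * m + 1 + 1 by ring]
      omega
    have hManti : ∀ j, M (j + 1) ≤ M j := fun j ↦ by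
      rcases Nat.even_or_odd j with ⟨m, rfl⟩ | ⟨m, rfl⟩
      · rw [← two_mul, hModd, hMeven]
        omega
      · rw [show 2 * m + 1 + 1 = 2 * (m + 1) by ring, hMeven, hModd, show 2 * m + 2 = 2 * (m + 1) by ring]
        have := hMr (2 * m); have := hMr (2 * m + 1)
        rw [show 2 * (m + 1) = 2 * m + 1 + 1 by ring]
        omega
    refine ⟨R, M, hManti, by rw [show (0 : ℕ) = 2 * 0 by ring, hMeven, mul_zero, hMr0], by rw [hMeven, hMr2R],
      fun m _ ↦ ?_, fun m _ ↦ ?_⟩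
    · rw [hdropW]
      rcases Nat.eq_zero_or_pos (Mr (2 * m + 1) - Mr (2 * m + 2)) with h0 | hpos
      · rw [h0]; exact exists_shaFamily_zero W K _
      · refine exists_shaFamily_W_of_forall_exists_avoiding_seed W K h2 σ hσ L hdiv hL g hg P₀ hP₀ (s := 2 * m + 2)
          (a := Mr (2 * m + 1) - Mr (2 * m + 2)) fun i hi u hu hord ↦ ?_
        obtain ⟨y, ⟨hysel, hyτ⟩, hyord, hyav⟩ := hsupEven m (by omega) i hi u
          (fun k ↦ ⟨(hu k).1, by rw [(hu k).2, hw, neg_neg, one_smul]⟩) hord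
        exact ⟨y, ⟨hysel, by rw [hyτ, hw, neg_neg, one_smul]⟩, hyord, hyav⟩
    · rw [hdropWd]
      rcases Nat.eq_zero_or_pos (Mr (2 * m) - Mr (2 * m + 1)) with h0 | hpos
      · rw [h0]; exact exists_shaFamily_zero Wd K _
      · refine exists_shaFamily_twin_of_forall_exists_avoiding_of_divisible W K h2 σ hσ L hL hWd hdivWd (s := 2 * m + 2)
          (a := Mr (2 * m) - Mr (2 * m + 1)) fun i hi u hu hord ↦ ?_
        obtain ⟨y, ⟨hysel, hyτ⟩, hyord, hyav⟩ := hsupOdd m (by omega) i hi u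
          (fun k ↦ ⟨(hu k).1, by rw [(hu k).2, hw, neg_one_zsmul]⟩) hord
        exact ⟨y, ⟨hysel, by rw [hyτ, hw, neg_one_zsmul]⟩, hyord, hyav⟩

end Summit.BirchSwinnertonDyer.BirchSwinnertonDyer.Theorems.GenusExact.PlusDescent

end
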